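import Literature.Geometry.DiscreteGeometry.SphericalCodeHullEuler
import HarnessLib

/-!
# Edges of the hull of a spherical code and Euler's formula `V − E + F = 2`

Topic `Literature/Geometry/DiscreteGeometry`.  Brick C₃ of the face theory of spherical
subdivisions (Musin–Tarasov 2012 §3; Fejes Tóth), completing `SphericalCodeHullEuler.lean`
(Legendre's identity `Σ_facets m_f = 2N + 2F − 4` for a finite set `X` of unit vectors of
`ℝ³` with `0 ∈ interior (conv X)`) by the EDGES of the subdivision and the incidence count
`Σ_f m_f = 2E`:

* `IsEdgeNormal X c₀` (`⟪c₀, ·⟫ ≤ 1` on `X` with exactly two tight points), `hullEdges X` (the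
  pairs `{y, y'} ⊆ X` spanning an exposed edge of `conv X`, as two-element `Finset`s);
* `pair_mem_hullEdges_of_consecutive`: consecutive vertices of a facet span a hull edge
  (exposing functional `c − ε·(facet functional of that edge)`);
  `consecutive_of_mem_hullEdges`: conversely a hull edge inside a facet joins CONSECUTIVE
  vertices (at a diagonal's midpoint every direction is feasible in the facet cone, and the
  exposing functional, dominated by the facet functional on the cone with equality at the
  midpoint, would coincide with it); hence `card_edgesOfFacet`: a facet with `m` vertices
  contains exactly `m` hull edges;
* `card_facetsOfEdge`: **every hull edge lies in exactly two facets** — by MEASURE, not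
  topology: at the edge midpoint the feasible cones of the facet cones through the edge tile
  space (`ConeTiling.sum_ballFraction_dirCone_argmaxCone`) and each is a closed half-space
  (fraction `½`, `dirCone_polyCone_edge`), so there are exactly two of them;
* **`euler_formula`**: `#hullEdges + 2 = #X + #facets`, i.e. `V − E + F = 2`; corollaries
  `card_hullEdges_le` (`E ≤ 3N − 6`), and for the CONTACT PAIRS of a spherical code (pairs at
  the maximal inner product `κ`, which span exposed edges, cf. `SphericalCodeHullEdges.lean`):
  `pair_mem_hullEdges_of_contact`, `card_contactPairs_le` (`≤ 3N − 6` contact pairs) — the edge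
  bound from Euler's formula for the planar contact graph [MusinTarasov2012, Props. 3.1, 3.4].

Everything is PROVED; no named facts.

## References
* L. Euler (1752); A.-M. Legendre, *Éléments de géométrie* (1794), VII.25. [folklore]
* O. R. Musin, A. S. Tarasov, DCG 48 (2012), §3. [`MusinTarasov2012`]
-/

noncomputable section

namespace Literature.Geometry.DiscreteGeometry

open Real RealInnerProductSpace MeasureTheory Metric Set InnerProductGeometry

local notation "E3" => EuclideanSpace ℝ (Fin 3)

/-! ### Part 0. Elementary tools -/

section Tools

/-- **Finitely many strict inequalities survive a small perturbation**: if `u i < v i` for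
`i ∈ s` then for some `ε > 0`, `u i + ε w i < v i` for all `i ∈ s`. [folklore] -/
theorem exists_pos_forall_add_mul_lt {ι : Type*} (s : Finset ι) (u v w : ι → ℝ)
    (h : ∀ i ∈ s, u i < v i) : ∃ ε : ℝ, 0 < ε ∧ ∀ i ∈ s, u i + ε * w i < v i := by
  by_cases hs : s.Nonempty
  · obtain ⟨i₀, hi₀, hmin⟩ := s.exists_min_image (fun i => (v i - u i) / (|w i| + 1)) hs
    set ε := (v i₀ - u i₀) / (|w i₀| + 1) with hε
    have hεpos : 0 < ε := div_pos (sub_pos.2 (h i₀ hi₀)) (by positivity)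
    refine ⟨ε, hεpos, fun i hi => ?_⟩
    have hle : ε ≤ (v i - u i) / (|w i| + 1) := hmin i hi
    rw [le_div_iff₀ (by positivity)] at hle
    have h1 : ε * w i ≤ ε * |w i| := mul_le_mul_of_nonneg_left (le_abs_self _) hεpos.le
    nlinarith [abs_nonneg (w i)]
  · exact ⟨1, one_pos, fun i hi => absurd ⟨i, hi⟩ hs⟩

/-- The successor modulo `n` of an index `< n`. [folklore] -/
theorem succ_mod_cases {n x : ℕ} (hx : x < n) :
    ((x + 1) % n = x + 1 ∧ x + 1 < n) ∨ ((x + 1) % n = 0 ∧ x + 1 = n) := by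
  rcases Nat.lt_or_ge (x + 1) n with h | h
  · exact Or.inl ⟨Nat.mod_eq_of_lt h, h⟩
  · exact Or.inr ⟨by rw [show x + 1 = n by omega, Nat.mod_self], by omega⟩

/-- **A vector pairing nonpositively with every feasible direction at a point where all
directions are feasible is zero** (test `±a`). [folklore] -/
theorem eq_zero_of_forall_dirCone_univ {V : Type*} [NormedAddCommGroup V] [InnerProductSpace ℝ V]
    {C : Set V} {p a : V} (hC : dirCone C p = univ) (h : ∀ x ∈ C, ⟪a, x⟫ ≤ ⟪a, p⟫) : a = 0 := by
  have key : ∀ d : V, ⟪a, d⟫ ≤ 0 := by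
    intro d
    have hd : d ∈ dirCone C p := by rw [hC]; trivial
    obtain ⟨ε, hε, hmem⟩ := hd
    have := h _ hmem
    rw [inner_add_right, real_inner_smul_right] at this
    nlinarith
  have h1 := key a
  have h2 := key (-a)
  rw [inner_neg_right] at h2
  have : ⟪a, a⟫ = 0 := le_antisymm h1 (by linarith)
  exact inner_self_eq_zero.1 this

/-- **A closed half-space through the centre has ball fraction `½`**, in determinant form
(`det[a;b;c] > 0` certifies that `det[b;c;·]` is a nonzero functional). [folklore] -/
theorem ballFraction_orient3_halfspace {a b c : E3} (h : 0 < orient3 a b c) :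
    ballFraction (0 : E3) {x : E3 | 0 ≤ orient3 b c x} = 1 / 2 := by
  rw [setOf_orient3_nonneg_eq h]
  have hn : triNormal a b c ≠ 0 :=
    triNormal_ne_zero (linearIndependent_of_orient3_ne_zero h.ne')
  rw [ballFraction, inter_comm, volume_halfspace_inter_ball hn, ENNReal.toReal_div]
  have hpos := volume_ball_toReal_pos (E := E3)
  have : ((2 : ENNReal)).toReal = 2 := by norm_num
  rw [this]
  field_simp

/-- `{y, y'} = {a, b}` as finsets with `y ≠ y'` forces `y + y' = a + b`. [folklore] -/
theorem add_eq_add_of_pair_eq {V : Type*} [AddCommGroup V] [DecidableEq V] {y y' a b : V}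
    (h : ({y, y'} : Finset V) = {a, b}) : y + y' = a + b := by
  have hy : y ∈ ({a, b} : Finset V) := h ▸ Finset.mem_insert_self y {y'}
  have hy' : y' ∈ ({a, b} : Finset V) := h ▸ Finset.mem_insert_of_mem (Finset.mem_singleton_self y')
  have ha : a ∈ ({y, y'} : Finset V) := h.symm ▸ Finset.mem_insert_self a {b}
  have hb : b ∈ ({y, y'} : Finset V) := h.symm ▸ Finset.mem_insert_of_mem (Finset.mem_singleton_self b)
  simp only [Finset.mem_insert, Finset.mem_singleton] at hy hy' ha hb
  rcases hy with rfl | rfl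
  · rcases hy' with rfl | rfl
    · rcases hb with rfl | rfl <;> rfl
    · rfl
  · rcases hy' with rfl | rfl
    · exact add_comm _ _
    · rcases ha with rfl | rfl <;> exact add_comm _ _

end Tools

/-! ### Part 1. Polygonal cones: feasible directions at edge midpoints and at diagonals -/

section PolyCone

/-- **At the midpoint of an edge only that edge's facet is active**: facet `i` vanishes at
`w j + w (j+1)` iff `i = j`. [folklore] -/
theorem orient3_consec_add_eq_zero_iff {n : ℕ} (hn : 3 ≤ n) {w : ℕ → E3}
    (hw : ∀ i j k, i < j → j < k → k < n → 0 < orient3 (w i) (w j) (w k)) {i j : ℕ} (hi : i < n)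
    (hj : j < n) :
    orient3 (w i) (w ((i + 1) % n)) (w j + w ((j + 1) % n)) = 0 ↔ i = j := by
  have hj1 : (j + 1) % n < n := Nat.mod_lt _ (by omega)
  rw [orient3_add_right]
  constructor
  · intro h0
    have ha : 0 ≤ orient3 (w i) (w ((i + 1) % n)) (w j) := mem_polyCone_vertex hw hj i hi
    have hb : 0 ≤ orient3 (w i) (w ((i + 1) % n)) (w ((j + 1) % n)) :=
      mem_polyCone_vertex hw hj1 i hi
    have ha0 : orient3 (w i) (w ((i + 1) % n)) (w j) = 0 := by linarith
    have hb0 : orient3 (w i) (w ((i + 1) % n)) (w ((j + 1) % n)) = 0 := by linarith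
    have hi1 : j = i ∨ j = (i + 1) % n := by
      by_contra hc
      push Not at hc
      exact (orient3_consec_pos hw hi hj hc.1 hc.2).ne' ha0
    have hi2 : (j + 1) % n = i ∨ (j + 1) % n = (i + 1) % n := by
      by_contra hc
      push Not at hc
      exact (orient3_consec_pos hw hi hj1 hc.1 hc.2).ne' hb0
    rcases succ_mod_cases hi with ⟨ei, li⟩ | ⟨ei, li⟩ <;>
      rcases succ_mod_cases hj with ⟨ej, lj⟩ | ⟨ej, lj⟩ <;>
        simp only [ei, ej] at hi1 hi2 <;> omega
  · rintro rfl
    rw [orient3_self_outer, orient3_self_right, add_zero]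

/-- **The feasible directions of a polygonal cone at the midpoint of an edge form the closed
half-space of that edge's facet.** [folklore] -/
theorem dirCone_polyCone_edge {n : ℕ} (hn : 3 ≤ n) {w : ℕ → E3}
    (hw : ∀ i j k, i < j → j < k → k < n → 0 < orient3 (w i) (w j) (w k)) {j : ℕ} (hj : j < n) :
    dirCone (polyCone n w) (w j + w ((j + 1) % n)) = {x : E3 | 0 ≤ orient3 (w j) (w ((j + 1) % n)) x} := by
  classical
  have hmem : w j + w ((j + 1) % n) ∈ polyCone n w :=
    add_mem_polyCone (mem_polyCone_vertex hw hj) (mem_polyCone_vertex hw (Nat.mod_lt _ (by omega)))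
  rw [polyCone_eq_halfspaceCone, dirCone_halfspaceCone (Finset.range n) _
    (by rwa [← polyCone_eq_halfspaceCone])]
  have hfilter : (Finset.range n).filter
      (fun i => orient3Right (w i) (w ((i + 1) % n)) (w j + w ((j + 1) % n)) = 0) = {j} := by
    ext i
    rw [Finset.mem_filter, Finset.mem_range, Finset.mem_singleton, orient3Right_apply]
    constructor
    · rintro ⟨hi, h0⟩
      exact (orient3_consec_add_eq_zero_iff hn hw hi hj).1 h0
    · rintro rfl
      exact ⟨hj, (orient3_consec_add_eq_zero_iff hn hw hj hj).2 rfl⟩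
  rw [hfilter]
  ext x
  simp only [halfspaceCone, Set.mem_setOf_eq, Finset.mem_singleton, forall_eq, orient3Right_apply]

/-- … whose ball fraction is `½`. [folklore] -/
theorem ballFraction_dirCone_polyCone_edge {n : ℕ} (hn : 3 ≤ n) {w : ℕ → E3}
    (hw : ∀ i j k, i < j → j < k → k < n → 0 < orient3 (w i) (w j) (w k)) {j : ℕ} (hj : j < n) :
    ballFraction (0 : E3) (dirCone (polyCone n w) (w j + w ((j + 1) % n))) = 1 / 2 := by
  rw [dirCone_polyCone_edge hn hw hj]
  -- a third edge ray strictly on the positive side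
  obtain ⟨k, hk, hkj, hkj'⟩ : ∃ k, k < n ∧ k ≠ j ∧ k ≠ (j + 1) % n := by
    rcases succ_mod_cases hj with ⟨e, l⟩ | ⟨e, l⟩
    · rcases Nat.lt_or_ge (j + 2) n with h2 | h2
      · exact ⟨j + 2, h2, by omega, by rw [e]; omega⟩
      · exact ⟨0, by omega, by omega, by rw [e]; omega⟩
    · exact ⟨1, by omega, by omega, by rw [e]; omega⟩
  have hpos : 0 < orient3 (w k) (w j) (w ((j + 1) % n)) := by
    rw [orient3_cyclic]
    exact orient3_consec_pos hw hj hk hkj hkj'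
  exact ballFraction_orient3_halfspace hpos

/-- **At the midpoint of a diagonal every direction is feasible** (no facet is active).
[folklore] -/
theorem dirCone_polyCone_diagonal {n : ℕ} {w : ℕ → E3}
    (hw : ∀ i j k, i < j → j < k → k < n → 0 < orient3 (w i) (w j) (w k)) {i j : ℕ} (hi : i < n)
    (hj : j < n) (hij : i ≠ j) (h1 : (i + 1) % n ≠ j) (h2 : (j + 1) % n ≠ i) :
    dirCone (polyCone n w) (w i + w j) = univ := by
  classical
  have hmem : w i + w j ∈ polyCone n w :=
    add_mem_polyCone (mem_polyCone_vertex hw hi) (mem_polyCone_vertex hw hj)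
  rw [polyCone_eq_halfspaceCone, dirCone_halfspaceCone (Finset.range n) _
    (by rwa [← polyCone_eq_halfspaceCone])]
  have hfilter : (Finset.range n).filter
      (fun k => orient3Right (w k) (w ((k + 1) % n)) (w i + w j) = 0) = ∅ := by
    rw [Finset.filter_eq_empty_iff]
    intro k hk h0
    rw [Finset.mem_range] at hk
    rw [orient3Right_apply, orient3_add_right] at h0
    have ha : 0 ≤ orient3 (w k) (w ((k + 1) % n)) (w i) := mem_polyCone_vertex hw hi k hk
    have hb : 0 ≤ orient3 (w k) (w ((k + 1) % n)) (w j) := mem_polyCone_vertex hw hj k hk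
    have ha0 : orient3 (w k) (w ((k + 1) % n)) (w i) = 0 := by linarith
    have hb0 : orient3 (w k) (w ((k + 1) % n)) (w j) = 0 := by linarith
    have hi1 : i = k ∨ i = (k + 1) % n := by
      by_contra hc
      push Not at hc
      exact (orient3_consec_pos hw hk hi hc.1 hc.2).ne' ha0
    have hj1 : j = k ∨ j = (k + 1) % n := by
      by_contra hc
      push Not at hc
      exact (orient3_consec_pos hw hk hj hc.1 hc.2).ne' hb0
    rcases hi1 with hi1 | hi1 <;> rcases hj1 with hj1 | hj1
    · exact hij (hi1.trans hj1.symm)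
    · exact h1 (by rw [hi1]; exact hj1.symm)
    · exact h2 (by rw [hj1]; exact hi1.symm)
    · exact hij (hi1.trans hj1.symm)
  rw [hfilter]
  ext x
  simp [halfspaceCone]

end PolyCone

/-! ### Part 2. Hull edges -/

section HullEdges

variable {V : Type*} [NormedAddCommGroup V] [InnerProductSpace ℝ V]

/-- **Edge normals** of `conv X` (normalised to `⟪c₀, ·⟫ = 1` on the edge): `⟪c₀, ·⟫ ≤ 1` on
`X` with exactly two tight points. [folklore] -/
def IsEdgeNormal (X : Finset V) (c₀ : V) : Prop :=
  (∀ y ∈ X, ⟪c₀, y⟫ ≤ 1) ∧ (tightSet X c₀).card = 2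

open scoped Classical in
/-- **The hull edges of `X`**: the two-element subsets of `X` spanning an exposed edge of
`conv X` (the tight sets of the edge normals). [folklore] -/
def hullEdges (X : Finset V) : Finset (Finset V) :=
  X.powerset.filter fun T => ∃ c₀ : V, IsEdgeNormal X c₀ ∧ tightSet X c₀ = T

/-- Membership in `hullEdges`. [folklore] -/
theorem mem_hullEdges {X : Finset V} {T : Finset V} :
    T ∈ hullEdges X ↔ ∃ c₀ : V, IsEdgeNormal X c₀ ∧ tightSet X c₀ = T := by
  classical
  unfold hullEdges
  rw [Finset.mem_filter, Finset.mem_powerset]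
  constructor
  · exact fun h => h.2
  · rintro ⟨c₀, hc₀, rfl⟩
    exact ⟨tightSet_subset X c₀, c₀, hc₀, rfl⟩

/-- Hull edges have two elements … [folklore] -/
theorem card_eq_two_of_mem_hullEdges {X : Finset V} {T : Finset V} (hT : T ∈ hullEdges X) :
    T.card = 2 := by
  obtain ⟨c₀, hc₀, rfl⟩ := mem_hullEdges.1 hT
  exact hc₀.2

/-- … and lie in `X`. [folklore] -/
theorem subset_of_mem_hullEdges {X : Finset V} {T : Finset V} (hT : T ∈ hullEdges X) : T ⊆ X := by
  obtain ⟨c₀, -, rfl⟩ := mem_hullEdges.1 hT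
  exact tightSet_subset X c₀

/-- `⟪c, ·⟫ = 1` on the hull of the tight set of `c`. [folklore] -/
theorem inner_eq_one_of_mem_convexHull_tightSet {X : Finset V} {c p : V}
    (hp : p ∈ convexHull ℝ ((tightSet X c : Finset V) : Set V)) : ⟪c, p⟫ = 1 := by
  refine le_antisymm ?_ ?_
  · exact inner_le_of_mem_convexHull (X := ((tightSet X c : Finset V) : Set V))
      (fun y hy => (mem_tightSet.1 (Finset.mem_coe.1 hy)).2.le) hp
  · have h := inner_le_of_mem_convexHull (X := ((tightSet X c : Finset V) : Set V)) (c := -c)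
      (m := -1) (fun y hy => by rw [inner_neg_left, (mem_tightSet.1 (Finset.mem_coe.1 hy)).2]) hp
    rw [inner_neg_left] at h
    linarith

end HullEdges

/-! ### Part 3. Hull edges inside a facet are the pairs of consecutive vertices -/

section FacetEdges

variable {X : Finset E3}

/-- **Consecutive vertices of a facet span a hull edge.** [folklore] -/
theorem pair_mem_hullEdges_of_consecutive (hX1 : ∀ y ∈ X, ‖y‖ = 1) {c : E3}
    (hcF : c ∈ facetNormals X) {j : ℕ}
    (hj : j < (facetAngles X c (ne_zero_of_mem_facetNormals hX1 hcF)).card) :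
    ({facetVertex X c (ne_zero_of_mem_facetNormals hX1 hcF) j,
      facetVertex X c (ne_zero_of_mem_facetNormals hX1 hcF)
        ((j + 1) % (facetAngles X c (ne_zero_of_mem_facetNormals hX1 hcF)).card)} : Finset E3) ∈
      hullEdges X := by
  classical
  set hc := ne_zero_of_mem_facetNormals hX1 hcF
  set m := (facetAngles X c hc).card with hm
  set w := facetVertex X c hc with hwdef
  have hm3 : 3 ≤ m := by rw [hm, card_facetAngles hX1 hc]; exact three_le_card_tightSet hcF
  have hw : ∀ i j k, i < j → j < k → k < m → 0 < orient3 (w i) (w j) (w k) :=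
    fun i j k hij hjk hk => orient3_facetVertex_pos hX1 hcF hij hjk hk
  have hj1 : (j + 1) % m < m := Nat.mod_lt _ (by omega)
  have hcX := (mem_facetNormals.1 hcF).1
  -- the edge functional as a vector
  set nv : E3 := (InnerProductSpace.toDual ℝ E3).symm
    (LinearMap.toContinuousLinearMap (orient3Right (w j) (w ((j + 1) % m)))) with hnv
  have hnvx : ∀ x, ⟪nv, x⟫ = orient3 (w j) (w ((j + 1) % m)) x := fun x => by
    rw [hnv, InnerProductSpace.toDual_symm_apply]; rfl
  -- uniform `ε` on the slack points
  obtain ⟨ε, hε, hεS⟩ := exists_pos_forall_add_mul_lt (X.filter fun y => ⟪c, y⟫ < 1)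
    (fun y => ⟪c, y⟫) (fun _ => 1) (fun y => -⟪nv, y⟫) (fun y hy => (Finset.mem_filter.1 hy).2)
  set c₀ : E3 := c - ε • nv with hc₀
  have hc₀y : ∀ y, ⟪c₀, y⟫ = ⟪c, y⟫ + ε * -⟪nv, y⟫ := fun y => by
    rw [hc₀, inner_sub_left, real_inner_smul_left]; ring
  -- values on `X`
  have hle : ∀ y ∈ X, ⟪c₀, y⟫ ≤ 1 := by
    intro y hy
    by_cases hyt : ⟪c, y⟫ = 1
    · -- tight for `c`: `y = w k`, and the edge functional is `≥ 0` there
      obtain ⟨k, hk, rfl⟩ := exists_facetVertex_eq hX1 hc (mem_tightSet.2 ⟨hy, hyt⟩)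
      rw [hc₀y, hyt, hnvx]
      have := mem_polyCone_vertex hw hk j hj
      nlinarith
    · have hlt : ⟪c, y⟫ < 1 := lt_of_le_of_ne (hcX y hy) hyt
      rw [hc₀y]
      exact (hεS y (Finset.mem_filter.2 ⟨hy, hlt⟩)).le
  have htight : tightSet X c₀ = {w j, w ((j + 1) % m)} := by
    ext y
    rw [mem_tightSet, Finset.mem_insert, Finset.mem_singleton]
    constructor
    · rintro ⟨hy, hy1⟩
      by_cases hyt : ⟪c, y⟫ = 1
      · obtain ⟨k, hk, rfl⟩ := exists_facetVertex_eq hX1 hc (mem_tightSet.2 ⟨hy, hyt⟩)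
        rw [hc₀y, hyt, hnvx] at hy1
        have h0 : orient3 (w j) (w ((j + 1) % m)) (w k) = 0 := by nlinarith
        by_contra hne
        push Not at hne
        have hkj : k ≠ j := fun h => hne.1 (by rw [h])
        have hkj' : k ≠ (j + 1) % m := fun h => hne.2 (by rw [h])
        exact (orient3_consec_pos hw hj hk hkj hkj').ne' h0
      · have hlt : ⟪c, y⟫ < 1 := lt_of_le_of_ne (hcX y hy) hyt
        have := hεS y (Finset.mem_filter.2 ⟨hy, hlt⟩)
        rw [hc₀y] at hy1
        linarith
    · rintro (rfl | rfl)
      · refine ⟨(mem_tightSet.1 (facetVertex_mem hc hj)).1, ?_⟩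
        rw [hc₀y, (mem_tightSet.1 (facetVertex_mem hc hj)).2, hnvx, orient3_self_outer]; ring
      · refine ⟨(mem_tightSet.1 (facetVertex_mem hc hj1)).1, ?_⟩
        rw [hc₀y, (mem_tightSet.1 (facetVertex_mem hc hj1)).2, hnvx, orient3_self_right]; ring
  have hne : w j ≠ w ((j + 1) % m) := by
    intro h
    have := facetVertex_injOn hc (Finset.mem_coe.2 (Finset.mem_range.2 hj))
      (Finset.mem_coe.2 (Finset.mem_range.2 hj1)) h
    rcases succ_mod_cases hj with ⟨e, l⟩ | ⟨e, l⟩ <;> rw [e] at this <;> omega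
  refine mem_hullEdges.2 ⟨c₀, ⟨hle, ?_⟩, htight⟩
  rw [htight, Finset.card_pair hne]

/-- **A hull edge inside a facet joins consecutive vertices.** [folklore] -/
theorem consecutive_of_mem_hullEdges (hX1 : ∀ y ∈ X, ‖y‖ = 1)
    (h0 : (0 : E3) ∈ interior (convexHull ℝ (X : Set E3))) {c : E3} (hcF : c ∈ facetNormals X)
    {T : Finset E3} (hT : T ∈ hullEdges X) (hTc : T ⊆ tightSet X c) :
    ∃ j, j < (facetAngles X c (ne_zero_of_mem_facetNormals hX1 hcF)).card ∧
      T = {facetVertex X c (ne_zero_of_mem_facetNormals hX1 hcF) j,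
        facetVertex X c (ne_zero_of_mem_facetNormals hX1 hcF)
          ((j + 1) % (facetAngles X c (ne_zero_of_mem_facetNormals hX1 hcF)).card)} := by
  classical
  set hc := ne_zero_of_mem_facetNormals hX1 hcF
  set m := (facetAngles X c hc).card with hm
  set w := facetVertex X c hc with hwdef
  have hm3 : 3 ≤ m := by rw [hm, card_facetAngles hX1 hc]; exact three_le_card_tightSet hcF
  have hw : ∀ i j k, i < j → j < k → k < m → 0 < orient3 (w i) (w j) (w k) :=
    fun i j k hij hjk hk => orient3_facetVertex_pos hX1 hcF hij hjk hk
  obtain ⟨c₀, hc₀, hT0⟩ := mem_hullEdges.1 hT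
  -- the two endpoints as facet vertices
  obtain ⟨y, y', hyy', hTeq⟩ := Finset.card_eq_two.1 (hT0 ▸ hc₀.2 : T.card = 2)
  have hyT : y ∈ T := by rw [hTeq]; exact Finset.mem_insert_self _ _
  have hy'T : y' ∈ T := by rw [hTeq]; exact Finset.mem_insert_of_mem (Finset.mem_singleton_self _)
  obtain ⟨i, hi, hwi⟩ := exists_facetVertex_eq hX1 hc (hTc hyT)
  obtain ⟨k, hk, hwk⟩ := exists_facetVertex_eq hX1 hc (hTc hy'T)
  have hik : i ≠ k := fun h => hyy' (by rw [← hwi, ← hwk, h])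
  -- consecutive one way or the other?
  by_cases h1 : (i + 1) % m = k
  · exact ⟨i, hi, by rw [hTeq, ← hwi, ← hwk, ← h1]⟩
  by_cases h2 : (k + 1) % m = i
  · exact ⟨k, hk, by rw [hTeq, ← hwi, ← hwk, ← h2, Finset.pair_comm]⟩
  -- otherwise `{y, y'}` is a diagonal: contradiction
  exfalso
  have hdiag : dirCone (argmaxCone (facetNormals X) c) (w i + w k) = univ := by
    rw [argmaxCone_eq_polyCone hX1 h0 hcF]
    exact dirCone_polyCone_diagonal hw hi hk hik h1 h2
  -- `⟪c₀ − c, ·⟫ ≤ 0` on the facet cone, `= 0` at `w i + w k`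
  have hdom : ∀ x ∈ argmaxCone (facetNormals X) c, ⟪c₀ - c, x⟫ ≤ ⟪c₀ - c, w i + w k⟫ := by
    intro x hx
    rw [argmaxCone_facetNormals_eq h0 hcF] at hx
    obtain ⟨t, ht, p, hp, rfl⟩ := hx
    have hcp : ⟪c, p⟫ = 1 := inner_eq_one_of_mem_convexHull_tightSet hp
    have hc₀p : ⟪c₀, p⟫ ≤ 1 := inner_le_one_of_mem_convexHull hc₀.1
      (convexHull_mono (Finset.coe_subset.2 (tightSet_subset X c)) hp)
    have hyi : ⟪c₀, w i⟫ = 1 := by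
      have := (mem_tightSet.1 (hT0.symm ▸ hyT)).2; rwa [← hwi] at this
    have hyk : ⟪c₀, w k⟫ = 1 := by
      have := (mem_tightSet.1 (hT0.symm ▸ hy'T)).2; rwa [← hwk] at this
    have hci : ⟪c, w i⟫ = 1 := (mem_tightSet.1 (facetVertex_mem hc hi)).2
    have hck : ⟪c, w k⟫ = 1 := (mem_tightSet.1 (facetVertex_mem hc hk)).2
    rw [inner_sub_left, inner_sub_left, real_inner_smul_right, real_inner_smul_right, hcp,
      inner_add_right, inner_add_right, hyi, hyk, hci, hck]
    nlinarith
  have hzero : c₀ - c = 0 := eq_zero_of_forall_dirCone_univ hdiag hdom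
  rw [sub_eq_zero] at hzero
  have h2' : (tightSet X c).card = 2 := hzero ▸ hc₀.2
  have h3 := three_le_card_tightSet hcF
  omega

open scoped Classical in
/-- **The hull edges inside the facet of `c`.** [folklore] -/
def edgesOfFacet (X : Finset E3) (c : E3) : Finset (Finset E3) :=
  (hullEdges X).filter fun T => T ⊆ tightSet X c

/-- They are the images of the consecutive index pairs. [folklore] -/
theorem edgesOfFacet_eq_image (hX1 : ∀ y ∈ X, ‖y‖ = 1)
    (h0 : (0 : E3) ∈ interior (convexHull ℝ (X : Set E3))) {c : E3} (hcF : c ∈ facetNormals X) :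
    edgesOfFacet X c =
      (Finset.range (facetAngles X c (ne_zero_of_mem_facetNormals hX1 hcF)).card).image
        fun j => ({facetVertex X c (ne_zero_of_mem_facetNormals hX1 hcF) j,
          facetVertex X c (ne_zero_of_mem_facetNormals hX1 hcF)
            ((j + 1) % (facetAngles X c (ne_zero_of_mem_facetNormals hX1 hcF)).card)} : Finset E3) := by
  classical
  set hc := ne_zero_of_mem_facetNormals hX1 hcF
  set m := (facetAngles X c hc).card with hm
  have hm3 : 3 ≤ m := by rw [hm, card_facetAngles hX1 hc]; exact three_le_card_tightSet hcF
  ext T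
  unfold edgesOfFacet
  rw [Finset.mem_filter, Finset.mem_image]
  constructor
  · rintro ⟨hT, hTc⟩
    obtain ⟨j, hj, rfl⟩ := consecutive_of_mem_hullEdges hX1 h0 hcF hT hTc
    exact ⟨j, Finset.mem_range.2 hj, rfl⟩
  · rintro ⟨j, hj, rfl⟩
    rw [Finset.mem_range] at hj
    refine ⟨pair_mem_hullEdges_of_consecutive hX1 hcF hj, ?_⟩
    intro y hy
    rw [Finset.mem_insert, Finset.mem_singleton] at hy
    rcases hy with rfl | rfl
    · exact facetVertex_mem hc hj
    · exact facetVertex_mem hc (Nat.mod_lt _ (by omega))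

/-- **A facet with `m` vertices has exactly `m` edges.** [folklore] -/
theorem card_edgesOfFacet (hX1 : ∀ y ∈ X, ‖y‖ = 1)
    (h0 : (0 : E3) ∈ interior (convexHull ℝ (X : Set E3))) {c : E3} (hcF : c ∈ facetNormals X) :
    (edgesOfFacet X c).card = (tightSet X c).card := by
  classical
  rw [edgesOfFacet_eq_image hX1 h0 hcF]
  set hc := ne_zero_of_mem_facetNormals hX1 hcF
  set m := (facetAngles X c hc).card with hm
  set w := facetVertex X c hc with hwdef
  have hm3 : 3 ≤ m := by rw [hm, card_facetAngles hX1 hc]; exact three_le_card_tightSet hcF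
  rw [Finset.card_image_of_injOn, Finset.card_range, hm, card_facetAngles hX1 hc]
  -- injectivity of `j ↦ {w j, w (j+1)}`
  intro j hj j' hj' h
  dsimp only at h
  have hjm : j < m := Finset.mem_range.1 (Finset.mem_coe.1 hj)
  have hj'm : j' < m := Finset.mem_range.1 (Finset.mem_coe.1 hj')
  have hinj : ∀ a b, a < m → b < m → w a = w b → a = b := fun a b ha hb hab =>
    facetVertex_injOn hc (Finset.mem_coe.2 (Finset.mem_range.2 ha))
      (Finset.mem_coe.2 (Finset.mem_range.2 hb)) hab
  have hmem : w j ∈ ({w j', w ((j' + 1) % m)} : Finset E3) := by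
    rw [← h]; exact Finset.mem_insert_self _ _
  rw [Finset.mem_insert, Finset.mem_singleton] at hmem
  rcases hmem with e | e
  · exact hinj j j' hjm hj'm e
  · -- `w j = w (j'+1)` and then `w (j+1) = w j'`: two steps around, impossible for `m ≥ 3`
    have e1 : j = (j' + 1) % m := hinj _ _ hjm (Nat.mod_lt _ (by omega)) e
    have hmem' : w ((j + 1) % m) ∈ ({w j', w ((j' + 1) % m)} : Finset E3) := by
      rw [← h]; exact Finset.mem_insert_of_mem (Finset.mem_singleton_self _)
    rw [Finset.mem_insert, Finset.mem_singleton] at hmem'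
    rcases hmem' with e2 | e2
    · have e3 : (j + 1) % m = j' := hinj _ _ (Nat.mod_lt _ (by omega)) hj'm e2
      exfalso
      rcases succ_mod_cases hjm with ⟨a, b⟩ | ⟨a, b⟩ <;>
        rcases succ_mod_cases hj'm with ⟨a', b'⟩ | ⟨a', b'⟩ <;>
          simp only [a, a'] at e1 e3 <;> omega
    · have e3 : (j + 1) % m = (j' + 1) % m := hinj _ _ (Nat.mod_lt _ (by omega))
        (Nat.mod_lt _ (by omega)) e2
      rcases succ_mod_cases hjm with ⟨a, b⟩ | ⟨a, b⟩ <;>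
        rcases succ_mod_cases hj'm with ⟨a', b'⟩ | ⟨a', b'⟩ <;>
          simp only [a, a'] at e1 e3 <;> omega

end FacetEdges

/-! ### Part 4. Every hull edge lies in exactly two facets -/

section TwoFacets

variable {X : Finset E3}

/-- The midpoint functional of a hull edge: a boundary point of the hull, hence on a facet, and a
facet containing the midpoint contains both endpoints. [folklore] -/
theorem exists_facet_of_mem_hullEdges
    (h0 : (0 : E3) ∈ interior (convexHull ℝ (X : Set E3))) {T : Finset E3} (hT : T ∈ hullEdges X) :
    ∃ c ∈ facetNormals X, T ⊆ tightSet X c := by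
  obtain ⟨c₀, hc₀, hT0⟩ := mem_hullEdges.1 hT
  obtain ⟨y, y', hyy', hTeq⟩ := Finset.card_eq_two.1 (hT0 ▸ hc₀.2 : T.card = 2)
  have hyT : y ∈ tightSet X c₀ := by rw [hT0, hTeq]; exact Finset.mem_insert_self _ _
  have hy'T : y' ∈ tightSet X c₀ := by
    rw [hT0, hTeq]; exact Finset.mem_insert_of_mem (Finset.mem_singleton_self _)
  have hy := mem_tightSet.1 hyT
  have hy' := mem_tightSet.1 hy'T
  -- the midpoint
  set mpt : E3 := (1 / 2 : ℝ) • (y + y') with hmpt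
  have hmX : mpt ∈ convexHull ℝ (X : Set E3) := by
    have hseg : mpt ∈ segment ℝ y y' := by
      refine ⟨1 / 2, 1 / 2, by norm_num, by norm_num, by norm_num, ?_⟩
      rw [hmpt, smul_add]
    exact segment_subset_convexHull (Finset.mem_coe.2 hy.1) (Finset.mem_coe.2 hy'.1) hseg
  have hc₀m : ⟪c₀, mpt⟫ = 1 := by
    rw [hmpt, real_inner_smul_right, inner_add_right, hy.2, hy'.2]; norm_num
  have hc₀0 : c₀ ≠ 0 := fun h => by rw [h, inner_zero_left] at hc₀m; exact zero_ne_one hc₀m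
  -- not an interior point: `c₀` attains its maximum `1` there
  have hmi : mpt ∉ interior (convexHull ℝ (X : Set E3)) := by
    intro hin
    obtain ⟨r, hr, hball⟩ := Metric.mem_nhds_iff.1 (mem_interior_iff_mem_nhds.1 hin)
    have hc₀n : 0 < ‖c₀‖ := norm_pos_iff.2 hc₀0
    have hmem : mpt + (r / 2 * ‖c₀‖⁻¹) • c₀ ∈ ball mpt r := by
      rw [mem_ball, dist_eq_norm, add_sub_cancel_left, norm_smul, Real.norm_eq_abs,
        abs_of_pos (by positivity), mul_assoc, inv_mul_cancel₀ hc₀n.ne', mul_one]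
      linarith
    have h1 := inner_le_one_of_mem_convexHull hc₀.1 (hball hmem)
    rw [inner_add_right, hc₀m, real_inner_smul_right, real_inner_self_eq_norm_sq] at h1
    have : 0 < r / 2 * ‖c₀‖⁻¹ * ‖c₀‖ ^ 2 := by positivity
    linarith
  obtain ⟨c, hc, hcm⟩ := exists_inner_eq_one_of_not_mem_interior h0 hmX hmi
  refine ⟨c, hc, ?_⟩
  have hcX := (mem_facetNormals.1 hc).1
  have h1 := hcX y hy.1
  have h2 := hcX y' hy'.1
  rw [hmpt, real_inner_smul_right, inner_add_right] at hcm
  have hcy : ⟪c, y⟫ = 1 := by linarith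
  have hcy' : ⟪c, y'⟫ = 1 := by linarith
  rw [hTeq]
  intro z hz
  rw [Finset.mem_insert, Finset.mem_singleton] at hz
  rcases hz with rfl | rfl
  · exact mem_tightSet.2 ⟨hy.1, hcy⟩
  · exact mem_tightSet.2 ⟨hy'.1, hcy'⟩

open scoped Classical in
/-- **The facets through a hull edge.** [folklore] -/
def facetsOfEdge (X : Finset E3) (T : Finset E3) : Finset E3 :=
  (facetNormals X).filter fun c => T ⊆ tightSet X c

/-- **Every hull edge lies in exactly two facets.** [folklore] -/
theorem card_facetsOfEdge (hX1 : ∀ y ∈ X, ‖y‖ = 1)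
    (h0 : (0 : E3) ∈ interior (convexHull ℝ (X : Set E3))) {T : Finset E3} (hT : T ∈ hullEdges X) :
    (facetsOfEdge X T).card = 2 := by
  classical
  obtain ⟨c₀, hc₀, hT0⟩ := mem_hullEdges.1 hT
  obtain ⟨y, y', hyy', hTeq⟩ := Finset.card_eq_two.1 (hT0 ▸ hc₀.2 : T.card = 2)
  have hyT : y ∈ T := by rw [hTeq]; exact Finset.mem_insert_self _ _
  have hy'T : y' ∈ T := by rw [hTeq]; exact Finset.mem_insert_of_mem (Finset.mem_singleton_self _)
  have hyX : y ∈ X := subset_of_mem_hullEdges hT hyT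
  have hy'X : y' ∈ X := subset_of_mem_hullEdges hT hy'T
  set p : E3 := y + y' with hp
  -- the maximisers at `p` are the facets through the edge
  obtain ⟨c₁, hc₁, hTc₁⟩ := exists_facet_of_mem_hullEdges h0 hT
  have hval : ∀ c ∈ facetNormals X, ⟪c, p⟫ ≤ 2 := fun c hc => by
    have h := (mem_facetNormals.1 hc).1
    rw [hp, inner_add_right]
    linarith [h y hyX, h y' hy'X]
  have hval2 : ∀ c ∈ facetNormals X, ⟪c, p⟫ = 2 ↔ T ⊆ tightSet X c := by
    intro c hc
    have h := (mem_facetNormals.1 hc).1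
    constructor
    · intro h2
      rw [hp, inner_add_right] at h2
      have e1 : ⟪c, y⟫ = 1 := by linarith [h y hyX, h y' hy'X]
      have e2 : ⟪c, y'⟫ = 1 := by linarith [h y hyX, h y' hy'X]
      rw [hTeq]
      intro z hz
      rw [Finset.mem_insert, Finset.mem_singleton] at hz
      rcases hz with rfl | rfl
      · exact mem_tightSet.2 ⟨hyX, e1⟩
      · exact mem_tightSet.2 ⟨hy'X, e2⟩
    · intro hsub
      rw [hp, inner_add_right, (mem_tightSet.1 (hsub hyT)).2, (mem_tightSet.1 (hsub hy'T)).2]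
      norm_num
  have hM : ∀ c, c ∈ facetsOfEdge X T ↔ c ∈ facetNormals X ∧ p ∈ argmaxCone (facetNormals X) c := by
    intro c
    unfold facetsOfEdge
    rw [Finset.mem_filter]
    constructor
    · rintro ⟨hc, hsub⟩
      refine ⟨hc, fun c' hc' => ?_⟩
      rw [(hval2 c hc).2 hsub]
      exact hval c' hc'
    · rintro ⟨hc, hmax⟩
      refine ⟨hc, (hval2 c hc).1 (le_antisymm (hval c hc) ?_)⟩
      rw [← (hval2 c₁ hc₁).2 hTc₁]
      exact hmax c₁ hc₁
  have hsum := sum_ballFraction_dirCone_argmaxCone (facetNormals X) (facetsOfEdge X T) p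
    (facetNormals_nonempty h0) hM
  -- each summand is `½`
  have hhalf : ∀ c ∈ facetsOfEdge X T,
      ballFraction (0 : E3) (dirCone (argmaxCone (facetNormals X) c) p) = 1 / 2 := by
    intro c hc
    have hcF : c ∈ facetNormals X := ((hM c).1 hc).1
    have hsub : T ⊆ tightSet X c := by
      unfold facetsOfEdge at hc; exact (Finset.mem_filter.1 hc).2
    obtain ⟨j, hj, hTj⟩ := consecutive_of_mem_hullEdges hX1 h0 hcF hT hsub
    set hc0 := ne_zero_of_mem_facetNormals hX1 hcF
    have hm3 : 3 ≤ (facetAngles X c hc0).card := by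
      rw [card_facetAngles hX1 hc0]; exact three_le_card_tightSet hcF
    have hpj : p = facetVertex X c hc0 j +
        facetVertex X c hc0 ((j + 1) % (facetAngles X c hc0).card) := by
      rw [hp]
      exact add_eq_add_of_pair_eq (hTeq.symm.trans hTj)
    rw [argmaxCone_eq_polyCone hX1 h0 hcF, hpj]
    exact ballFraction_dirCone_polyCone_edge hm3
      (fun i j k hij hjk hk => orient3_facetVertex_pos hX1 hcF hij hjk hk) hj
  rw [Finset.sum_congr rfl hhalf, Finset.sum_const, nsmul_eq_mul] at hsum
  have : ((facetsOfEdge X T).card : ℝ) = 2 := by linarith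
  exact_mod_cast this

end TwoFacets

/-! ### Part 5. Euler's formula -/

section EulerFormula

variable {X : Finset E3}

/-- **Incidences: `Σ_f m_f = 2E`.** [folklore] -/
theorem sum_card_tightSet_eq_two_mul_card_hullEdges (hX1 : ∀ y ∈ X, ‖y‖ = 1)
    (h0 : (0 : E3) ∈ interior (convexHull ℝ (X : Set E3))) :
    ∑ c ∈ facetNormals X, (tightSet X c).card = 2 * (hullEdges X).card := by
  classical
  calc ∑ c ∈ facetNormals X, (tightSet X c).card
      = ∑ c ∈ facetNormals X, (edgesOfFacet X c).card :=
        Finset.sum_congr rfl fun c hc => (card_edgesOfFacet hX1 h0 hc).symm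
    _ = ∑ c ∈ facetNormals X, ∑ T ∈ edgesOfFacet X c, 1 := by simp
    _ = ∑ T ∈ hullEdges X, ∑ c ∈ facetsOfEdge X T, 1 := by
        refine Finset.sum_comm' fun c T => ?_
        unfold edgesOfFacet facetsOfEdge
        rw [Finset.mem_filter, Finset.mem_filter]
        tauto
    _ = ∑ T ∈ hullEdges X, 2 := Finset.sum_congr rfl fun T hT => by
        rw [Finset.sum_const, smul_eq_mul, mul_one, card_facetsOfEdge hX1 h0 hT]
    _ = 2 * (hullEdges X).card := by rw [Finset.sum_const, smul_eq_mul, mul_comm]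

/-- **Euler's formula for the hull of a spherical code**: `E + 2 = V + F` for the vertices
`X`, the hull edges and the facets of `conv X` (`X ⊂ S²` finite, `0 ∈ interior (conv X)`).
[cite: MusinTarasov2012, §3.1, Prop. 3.4 ("Using Euler's formula")] -/
theorem euler_formula (hX1 : ∀ y ∈ X, ‖y‖ = 1)
    (h0 : (0 : E3) ∈ interior (convexHull ℝ (X : Set E3))) :
    (hullEdges X).card + 2 = X.card + (facetNormals X).card := by
  have h1 := sum_card_tightSet_eq hX1 h0
  have h2 := sum_card_tightSet_eq_two_mul_card_hullEdges hX1 h0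
  have h2' : (∑ c ∈ facetNormals X, ((tightSet X c).card : ℝ)) = 2 * (hullEdges X).card := by
    exact_mod_cast h2
  have : ((hullEdges X).card : ℝ) + 2 = X.card + (facetNormals X).card := by linarith
  exact_mod_cast this

/-- **At most `3N − 6` edges.** [folklore] -/
theorem card_hullEdges_le (hX1 : ∀ y ∈ X, ‖y‖ = 1)
    (h0 : (0 : E3) ∈ interior (convexHull ℝ (X : Set E3))) :
    (hullEdges X).card + 6 ≤ 3 * X.card := by
  have h1 := euler_formula hX1 h0
  have h2 := card_facetNormals_le hX1 h0
  omega

/-- **Exactly `3N − 6` edges for a simplicial hull.** [folklore] -/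
theorem card_hullEdges_eq_of_simplicial (hX1 : ∀ y ∈ X, ‖y‖ = 1)
    (h0 : (0 : E3) ∈ interior (convexHull ℝ (X : Set E3)))
    (htri : ∀ c ∈ facetNormals X, (tightSet X c).card = 3) :
    (hullEdges X).card + 6 = 3 * X.card := by
  have h1 := euler_formula hX1 h0
  have h2 := card_facetNormals_eq_of_simplicial hX1 h0 htri
  omega

end EulerFormula

/-! ### Part 6. Contact pairs are hull edges -/

section Contact

variable {X : Finset E3}

/-- **A contact pair spans a hull edge**: if all inner products of distinct points of `X` are
`≤ κ` (`−1 < κ`) and `⟪u, v⟫ = κ` for `u ≠ v` in `X`, then `{u, v} ∈ hullEdges X`, exposed by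
`(u + v)/(1 + κ)`. [cite: MusinTarasov2012, §3.1 (proof of Prop. 3.1)] -/
theorem pair_mem_hullEdges_of_contact (hX1 : ∀ y ∈ X, ‖y‖ = 1) {κ : ℝ} (hκ : -1 < κ)
    (hXκ : ∀ u ∈ X, ∀ v ∈ X, u ≠ v → ⟪u, v⟫ ≤ κ) {u v : E3} (hu : u ∈ X) (hv : v ∈ X)
    (hne : u ≠ v) (huv : ⟪u, v⟫ = κ) : ({u, v} : Finset E3) ∈ hullEdges X := by
  classical
  have hκ1 : κ < 1 := huv ▸ inner_lt_one_of_ne_unit (hX1 u hu) (hX1 v hv) hne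
  have h1κ : 0 < 1 + κ := by linarith
  have huu : ⟪u, u⟫ = 1 := by rw [real_inner_self_eq_norm_sq, hX1 u hu]; norm_num
  have hvv : ⟪v, v⟫ = 1 := by rw [real_inner_self_eq_norm_sq, hX1 v hv]; norm_num
  set c₀ : E3 := (1 + κ)⁻¹ • (u + v) with hc₀
  have hc₀y : ∀ y, ⟪c₀, y⟫ = (1 + κ)⁻¹ * (⟪u, y⟫ + ⟪v, y⟫) := fun y => by
    rw [hc₀, real_inner_smul_left, inner_add_left]
  have hc₀u : ⟪c₀, u⟫ = 1 := by
    rw [hc₀y, huu, real_inner_comm, huv, inv_mul_cancel₀ h1κ.ne']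
  have hc₀v : ⟪c₀, v⟫ = 1 := by
    rw [hc₀y, huv, hvv, add_comm κ 1, inv_mul_cancel₀ h1κ.ne']
  have hlt : ∀ y ∈ X, y ≠ u → y ≠ v → ⟪c₀, y⟫ < 1 := by
    intro y hy hyu hyv
    rw [hc₀y, inv_mul_lt_iff₀ h1κ, mul_one]
    have h1 := hXκ u hu y hy (Ne.symm hyu)
    have h2 := hXκ v hv y hy (Ne.symm hyv)
    linarith
  have hle : ∀ y ∈ X, ⟪c₀, y⟫ ≤ 1 := by
    intro y hy
    by_cases hyu : y = u
    · rw [hyu, hc₀u]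
    by_cases hyv : y = v
    · rw [hyv, hc₀v]
    exact (hlt y hy hyu hyv).le
  have htight : tightSet X c₀ = {u, v} := by
    ext y
    rw [mem_tightSet, Finset.mem_insert, Finset.mem_singleton]
    constructor
    · rintro ⟨hy, hy1⟩
      by_contra h
      push Not at h
      exact (hlt y hy h.1 h.2).ne hy1
    · rintro (rfl | rfl)
      · exact ⟨hu, hc₀u⟩
      · exact ⟨hv, hc₀v⟩
  refine mem_hullEdges.2 ⟨c₀, ⟨hle, ?_⟩, htight⟩
  rw [htight, Finset.card_pair hne]

open scoped Classical in
/-- **The contact pairs of `X` at level `κ`**, as two-element subsets. [folklore] -/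
def contactPairsAt (X : Finset E3) (κ : ℝ) : Finset (Finset E3) :=
  X.powerset.filter fun T => ∃ u v : E3, u ≠ v ∧ ⟪u, v⟫ = κ ∧ T = {u, v}

/-- Contact pairs are hull edges. [folklore] -/
theorem contactPairsAt_subset_hullEdges (hX1 : ∀ y ∈ X, ‖y‖ = 1) {κ : ℝ} (hκ : -1 < κ)
    (hXκ : ∀ u ∈ X, ∀ v ∈ X, u ≠ v → ⟪u, v⟫ ≤ κ) : contactPairsAt X κ ⊆ hullEdges X := by
  classical
  intro T hT
  unfold contactPairsAt at hT
  rw [Finset.mem_filter, Finset.mem_powerset] at hT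
  obtain ⟨hTX, u, v, hne, huv, rfl⟩ := hT
  have hu : u ∈ X := hTX (Finset.mem_insert_self _ _)
  have hv : v ∈ X := hTX (Finset.mem_insert_of_mem (Finset.mem_singleton_self _))
  exact pair_mem_hullEdges_of_contact hX1 hκ hXκ hu hv hne huv

/-- **A spherical code with `0` in the interior of its hull has at most `3N − 6` contact pairs**
— the edge bound of Euler's formula for its (planar) contact graph.
[cite: MusinTarasov2012, Props. 3.1 and 3.4] -/
theorem card_contactPairsAt_le (hX1 : ∀ y ∈ X, ‖y‖ = 1)
    (h0 : (0 : E3) ∈ interior (convexHull ℝ (X : Set E3))) {κ : ℝ} (hκ : -1 < κ)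
    (hXκ : ∀ u ∈ X, ∀ v ∈ X, u ≠ v → ⟪u, v⟫ ≤ κ) :
    (contactPairsAt X κ).card + 6 ≤ 3 * X.card := by
  have h1 := Finset.card_le_card (contactPairsAt_subset_hullEdges hX1 hκ hXκ)
  have h2 := card_hullEdges_le hX1 h0
  omega

end Contact

end Literature.Geometry.DiscreteGeometry
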